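import Summits.ValiantsHypothesis.ValiantsHypothesis.Theorems.LacunarySymmetroidMatrixDescartesDoorA26WallBubblingBubblingExpNewtonRobust

/-!
# Real exponential sums: the ROBUST exponential Newton inequalities for `n` active classes — line `wall_bubbling`, W4 (file 4b)

Sequel of `…BubblingExpNewtonRobust` (robust three-term ENS).  Helper for the line `Cruxes/DoorA26/Lines/wall_bubbling.lean`
(stmt-ValiantsHypothesis-19979), obligation (M): the LIMIT form of soundness-ledger item (v) of the second-order sieve
(`Lines/wall_bubbling_M-sieve.md` §2.4: «a far cluster K with n active classes carries n−1 zeros (saturation), so its limit coefficients are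
ENS-concave»; statement of record `Cruxes/DoorA26/Lines/wall_bubbling_ENS.lean`, whose docstring notes that the sieve applies ENS to LIMIT functions
of clusters, where zeros may merge).  Seat val-sym-lift-p1 (g19), W4; `--supports stmt-ValiantsHypothesis-19979 --as helper`.  Proved here:
* `classSum_mul_sub`, `weight_erase'`, `erase_triple` (bookkeeping of the `(d/dt − m)` step and of three-point weights);
* **`ens_concave_robust`** — `(a ν, x ν) → (a₀, x₀)` coefficientwise/exponentwise, `V` the ACTIVE limit classes, and FREQUENTLY in `ν` the sum
  `g_ν` has `#V − 1` distinct zeros in the window `[−R, R]` ⇒ at every consecutive triple `u < v < w` of `V` the limit class sums satisfy the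
  NON-STRICT weighted log-concavity `(w−v)·log c_u + (v−u)·log c_w ≤ (w−u)·log c_v`, `c_s = |classSum a₀ x₀ s|·Π_{s' ∈ V∖s}|s − s'|`
  (induction: a `(d/dt − m)` step at the extreme active limit exponent `m` keeps convergence, costs one zero inside the window
  (`card_zeros_le_card_zeros_twistDeriv_add_one`), deactivates exactly `m`, and fixes the weights; base = `three_term_ens_robust`).
HONEST FRAMING.  Classical real analysis; a kernel version of an instrument lemma in the form it is consumed; (M)/(W) OPEN; nothing on `DoorA26`,
`MatrixDescartes` (stmt-18050) or VP ≠ VNP.  No definitions.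
-/

-- `Summit.ValiantsHypothesis.ValiantsHypothesis.…` repeats a component by the D-0017 layout (single-conjunct summit); the name is mandated.
set_option linter.dupNamespace false
set_option autoImplicit false

namespace Summit.ValiantsHypothesis.ValiantsHypothesis.Theorems.LacunarySymmetroidMatrixDescartes.WallBubbling.Bubbling

open Finset Filter Topology Real

variable {ι : Type*} [Fintype ι]

/-- the weights are invariant under the `(d/dt − m)` step: for `x ≠ m ∈ S`,
`|a_x(x−m)|·Π_{s ∈ (S∖{m})∖{x}} |x−s| = |a_x|·Π_{s ∈ S∖{x}} |x−s|`. [bookkeeping] -/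
theorem weight_erase' (S : Finset ℝ) (a : ℝ → ℝ) {m x : ℝ} (hm : m ∈ S) (hxm : x ≠ m) :
    |a x * (x - m)| * ∏ s ∈ (S.erase m).erase x, |x - s| = |a x| * ∏ s ∈ S.erase x, |x - s| := by
  have hmem : m ∈ S.erase x := Finset.mem_erase.2 ⟨hxm.symm, hm⟩
  rw [← Finset.mul_prod_erase (S.erase x) (fun s => |x - s|) hmem, Finset.erase_right_comm, abs_mul]
  ring

/-! ## The robust ENS theorem for `n` active classes -/

/-- class sums of the `(d/dt − m)`-family: `classSum (aᵢ(xᵢ − m)) x s = (s − m)·classSum a x s`. [bookkeeping] -/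
theorem classSum_mul_sub (a x : ι → ℝ) (m s : ℝ) :
    classSum (fun i => a i * (x i - m)) x s = (s - m) * classSum a x s := by
  unfold classSum
  rw [Finset.mul_sum]
  refine Finset.sum_congr rfl fun i _ => ?_
  dsimp only
  by_cases h : x i = s
  · rw [if_pos h, if_pos h, h]; ring
  · rw [if_neg h, if_neg h, mul_zero]

/-- the erased triples `{u,v,w} ∖ v = {u,w}`, `{u,v,w} ∖ w = {u,v}` (distinct reals). [bookkeeping] -/
theorem erase_triple {u v w : ℝ} (huv : u ≠ v) (huw : u ≠ w) (hvw : v ≠ w) :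
    ({u, v, w} : Finset ℝ).erase v = {u, w} ∧ ({u, v, w} : Finset ℝ).erase w = {u, v} := by
  constructor
  · ext s; simp only [Finset.mem_erase, Finset.mem_insert, Finset.mem_singleton]
    constructor
    · rintro ⟨h1, h2 | h2 | h2⟩
      · exact Or.inl h2
      · exact absurd h2 h1
      · exact Or.inr h2
    · rintro (h | h)
      · exact ⟨by rw [h]; exact huv, Or.inl h⟩
      · exact ⟨by rw [h]; exact hvw.symm, Or.inr (Or.inr h)⟩
  · ext s; simp only [Finset.mem_erase, Finset.mem_insert, Finset.mem_singleton]
    constructor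
    · rintro ⟨h1, h2 | h2 | h2⟩
      · exact Or.inl h2
      · exact Or.inr h2
      · exact absurd h2 h1
    · rintro (h | h)
      · exact ⟨by rw [h]; exact huw, Or.inl h⟩
      · exact ⟨by rw [h]; exact hvw, Or.inr (Or.inl h)⟩

/-- **ROBUST ENS.**  `(a ν, x ν) → (a₀, x₀)` coefficientwise and exponentwise; `V` = the set of ACTIVE limit classes (`classSum a₀ x₀ s ≠ 0 ↔ s ∈ V`);
FREQUENTLY in `ν` the sum `g_ν` has `#V − 1` distinct zeros in the window `[−R, R]`.  Then at every consecutive triple `u < v < w` of `V` the limit class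
sums are weighted-log-concave (non-strict), weights `c_s = |classSum a₀ x₀ s|·Π_{s' ∈ V, s' ≠ s}|s − s'|`. [this file] -/
theorem ens_concave_robust (n : ℕ) : ∀ (a x : ℕ → ι → ℝ) (a₀ x₀ : ι → ℝ) (V : Finset ℝ),
    (∀ i, Tendsto (fun ν => a ν i) atTop (𝓝 (a₀ i))) → (∀ i, Tendsto (fun ν => x ν i) atTop (𝓝 (x₀ i))) →
    (∀ s, classSum a₀ x₀ s ≠ 0 ↔ s ∈ V) → V.card = n →
    ∀ R : ℝ, (∃ᶠ ν in atTop, ∃ Z : Finset ℝ, (∀ z ∈ Z, z ∈ Set.Icc (-R) R ∧ expSum (a ν) (x ν) z = 0) ∧ V.card ≤ Z.card + 1) →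
    ∀ u v w : ℝ, u ∈ V → v ∈ V → w ∈ V → u < v → v < w → (∀ s ∈ V, s ≤ u ∨ s = v ∨ w ≤ s) →
      (w - v) * log (|classSum a₀ x₀ u| * ∏ s ∈ V.erase u, |u - s|) + (v - u) * log (|classSum a₀ x₀ w| * ∏ s ∈ V.erase w, |w - s|) ≤
        (w - u) * log (|classSum a₀ x₀ v| * ∏ s ∈ V.erase v, |v - s|) := by
  classical
  induction n using Nat.strong_induction_on with
  | _ n ih =>
  intro a x a₀ x₀ V ha hx hact hcard R hfreq u v w hu hv hw huv hvw hcov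
  have hVne : V.Nonempty := ⟨u, hu⟩
  -- the `(d/dt − M)` step at an extreme ACTIVE limit exponent `M ∉ {u, v, w}`
  have step : ∀ M, M ∈ V → u ≠ M → v ≠ M → w ≠ M →
      (w - v) * log (|classSum a₀ x₀ u| * ∏ s ∈ V.erase u, |u - s|) + (v - u) * log (|classSum a₀ x₀ w| * ∏ s ∈ V.erase w, |w - s|) ≤
        (w - u) * log (|classSum a₀ x₀ v| * ∏ s ∈ V.erase v, |v - s|) := by
    intro M hMV hMu hMv hMw
    set a' : ℕ → ι → ℝ := fun ν i => a ν i * (x ν i - M) / 1 with ha'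
    set a₀' : ι → ℝ := fun i => a₀ i * (x₀ i - M) with ha₀'
    have ha't : ∀ i, Tendsto (fun ν => a' ν i) atTop (𝓝 (a₀' i)) := by
      intro i
      have := (ha i).mul ((hx i).sub_const M)
      simpa [ha'] using this
    have hcl : ∀ s, classSum a₀' x₀ s = (s - M) * classSum a₀ x₀ s := fun s => classSum_mul_sub a₀ x₀ M s
    have hact' : ∀ s, classSum a₀' x₀ s ≠ 0 ↔ s ∈ V.erase M := by
      intro s
      rw [hcl, Finset.mem_erase, ← hact s, mul_ne_zero_iff, sub_ne_zero]
    have hfreq' : ∃ᶠ ν in atTop, ∃ Z : Finset ℝ, (∀ z ∈ Z, z ∈ Set.Icc (-R) R ∧ expSum (a' ν) (x ν) z = 0) ∧ (V.erase M).card ≤ Z.card + 1 := by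
      refine hfreq.mono fun ν hν => ?_
      obtain ⟨Z, hZ, hZc⟩ := hν
      obtain ⟨Z', hcardZ, hZ'⟩ := card_zeros_le_card_zeros_twistDeriv_add_one (a ν) (x ν) M 1 (-R) R Z hZ
      refine ⟨Z', hZ', ?_⟩
      rw [Finset.card_erase_of_mem hMV]; omega
    have h := ih (n - 1) (by have := Finset.card_pos.2 hVne; omega) a' x a₀' x₀ (V.erase M) ha't hx hact'
      (by rw [Finset.card_erase_of_mem hMV]; omega) R hfreq' u v w
      (Finset.mem_erase.2 ⟨hMu, hu⟩) (Finset.mem_erase.2 ⟨hMv, hv⟩) (Finset.mem_erase.2 ⟨hMw, hw⟩) huv hvw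
      (fun s hs => hcov s (Finset.mem_of_mem_erase hs))
    have hwt : ∀ y, y ≠ M → |classSum a₀' x₀ y| * ∏ s ∈ (V.erase M).erase y, |y - s| = |classSum a₀ x₀ y| * ∏ s ∈ V.erase y, |y - s| := by
      intro y hy
      rw [hcl, mul_comm (y - M), weight_erase' V (fun s => classSum a₀ x₀ s) hMV hy]
    rwa [hwt u hMu, hwt v hMv, hwt w hMw] at h
  by_cases htop : w < V.max' hVne
  · have hMV := Finset.max'_mem V hVne
    refine step _ hMV ?_ ?_ (ne_of_lt htop)
    · intro h; rw [h] at huv; linarith [Finset.le_max' V v hv]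
    · intro h; rw [← h] at htop; linarith
  by_cases hbot : V.min' hVne < u
  · have hMV := Finset.min'_mem V hVne
    refine step _ hMV (ne_of_gt hbot) ?_ ?_
    · intro h; rw [← h] at hbot; linarith
    · intro h; rw [h] at hvw; linarith [Finset.min'_le V v hv]
  -- `V = {u, v, w}`
  push Not at htop hbot
  have hVeq : V = {u, v, w} := by
    ext s
    simp only [Finset.mem_insert, Finset.mem_singleton]
    constructor
    · intro hs
      rcases hcov s hs with h | h | h
      · exact Or.inl (le_antisymm h (hbot.trans (Finset.min'_le V s hs)))
      · exact Or.inr (Or.inl h)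
      · exact Or.inr (Or.inr (le_antisymm ((Finset.le_max' V s hs).trans htop) h))
    · rintro (rfl | rfl | rfl)
      · exact hu
      · exact hv
      · exact hw
  have huv' : u ≠ v := ne_of_lt huv
  have huw : u ≠ w := ne_of_lt (huv.trans hvw)
  have hvw' : v ≠ w := ne_of_lt hvw
  have hU : classSum a₀ x₀ u ≠ 0 := (hact u).2 hu
  have hV : classSum a₀ x₀ v ≠ 0 := (hact v).2 hv
  have hW : classSum a₀ x₀ w ≠ 0 := (hact w).2 hw
  have honly : ∀ s, classSum a₀ x₀ s ≠ 0 → s = u ∨ s = v ∨ s = w := by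
    intro s hs
    have := (hact s).1 hs
    rw [hVeq, Finset.mem_insert, Finset.mem_insert, Finset.mem_singleton] at this
    exact this
  have hfreq2 : ∃ᶠ ν in atTop, ∃ t₁ t₂, t₁ ∈ Set.Icc (-R) R ∧ t₂ ∈ Set.Icc (-R) R ∧ t₁ ≠ t₂ ∧
      expSum (a ν) (x ν) t₁ = 0 ∧ expSum (a ν) (x ν) t₂ = 0 := by
    refine hfreq.mono fun ν hν => ?_
    obtain ⟨Z, hZ, hZc⟩ := hν
    have hZ2 : 1 < Z.card := by
      rw [hVeq, Finset.card_insert_of_notMem (by simp [huv', huw]), Finset.card_insert_of_notMem (by simp [hvw']),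
        Finset.card_singleton] at hZc; omega
    obtain ⟨t₁, ht₁, t₂, ht₂, hne⟩ := Finset.one_lt_card.1 hZ2
    exact ⟨t₁, t₂, (hZ t₁ ht₁).1, (hZ t₂ ht₂).1, hne, (hZ t₁ ht₁).2, (hZ t₂ ht₂).2⟩
  have h3 := three_term_ens_robust a x a₀ x₀ ha hx u v w huv hvw hU hV hW honly R hfreq2
  -- the weights over `V = {u,v,w}`
  have pu : ∏ s ∈ V.erase u, |u - s| = (v - u) * (w - u) := by
    rw [hVeq, show ({u, v, w} : Finset ℝ).erase u = {v, w} by rw [Finset.erase_insert (by simp [huv', huw])],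
      Finset.prod_insert (by simp [hvw']), Finset.prod_singleton, abs_of_neg (by linarith), abs_of_neg (by linarith)]; ring
  obtain ⟨ev, ew⟩ := erase_triple huv' huw hvw'
  have pv : ∏ s ∈ V.erase v, |v - s| = (v - u) * (w - v) := by
    rw [hVeq, ev, Finset.prod_insert (by simp [huw]), Finset.prod_singleton, abs_of_pos (by linarith), abs_of_neg (by linarith)]; ring
  have pw : ∏ s ∈ V.erase w, |w - s| = (w - u) * (w - v) := by
    rw [hVeq, ew, Finset.prod_insert (by simp [huv']), Finset.prod_singleton, abs_of_pos (by linarith), abs_of_pos (by linarith)]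
  rw [pu, pv, pw]
  exact h3

end Summit.ValiantsHypothesis.ValiantsHypothesis.Theorems.LacunarySymmetroidMatrixDescartes.WallBubbling.Bubbling
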